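import Literature.ModelTheory.ExponentialFields.SemialgebraicPanelBeating
import HarnessLib

/-!
# Flat reparametrization of a laminar family (Pawłucki's smoothing homeomorphism `ω`, `p = 1`)

Topic `Literature/ModelTheory/ExponentialFields` — a building block of the `C¹`-triangulation
theorem for compact semialgebraic sets
(`Literature.ModelTheory.ExponentialFields.OhmotoShiota2017_c1Triangulation`, statement of
[OhmotoShiota2017, Thm. 1.1]), following the *correct* proof of W. Pawłucki [Pawlucki2024]
specialized to `p = 1`.  This file is the one-variable "smoothing homeomorphism with parameters"
of [Pawlucki2024, §4, Cor. 4.4–4.5], in the first-order form that suffices for `p = 1`: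
given finitely many nodes `y₀ ≤ y₁ ≤ ⋯ ≤ y_r` (depending continuously on a parameter), the map

`ω(s) = y₀ + ∑_{j < r} Δ_j · φ((s - κ_j) / W_j)`, `Δ_j = y_{j+1} - y_j`, `W_j = √Δ_j`,
`κ_j = ∑_{i<j} W_i`, `φ` = the cubic smoothstep,

is an increasing `C¹` homeomorphism `[0, κ_r] → [y₀, y_r]` with `ω(κ_j) = y_j`, `ω'(κ_j) = 0`,
`|ω'| ≤ (3/2) max_j W_j`, jointly continuous in the parameters together with `ω'` (the degenerate
pieces `Δ_j = 0` need no case distinction: their terms vanish).  The main export is the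
composition lemma [Pawlucki2024, Lemma 4.3 / Cor. 4.4 for `p = 1`]: if `θ(x, ·)` is continuous on
`[y₀(x), y_r(x)]` and differentiable on the open pieces with `‖∂_t θ‖ ≤ L` (jointly continuous
derivative there), then `s ↦ θ(x, ω_x(s))` is differentiable on `(0, κ_r(x))` with derivative
`ω'_x(s) • ∂_tθ(x, ω_x(s))`, and this derivative, extended by the same formula, is **jointly
continuous on the whole parameter space and vanishes at all nodes** — in particular it "extends
continuously by zero" to the boundary of every capsule, pinch points included
([Pawlucki2024, (5.1.2), (5.1.5), (8.1.8)]).  For `p = 1` no Yomdin–Gromov lemma is needed: a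
bounded first derivative is enough (loc. cit., Lemma 4.3 with `p = 1`).

Also: the partial inverse of a continuous injective map on a compact set is continuous
(`continuousOn_invFunOn_of_isCompact_injOn`, used for all fibrewise inverses of the
construction), and the semialgebraicity of `ω` in all variables.

No named facts are introduced (D-0026); `frGap`, `frW`, `frNode`, `frOmega`, `frOmegaD` are
definitions with bodies.

## References

* [Pawlucki2024] W. Pawłucki, *Strict `C^p`-triangulations — a new approach to
  desingularization*, J. Eur. Math. Soc. 26 (2024), 3863–3909, §4 (Lemma 4.3, Cor. 4.4, 4.5),
  Lemma 5.1 (5.1.2), (5.1.5).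
* [OhmotoShiota2017] T. Ohmoto, M. Shiota, *`C¹`-triangulations of semialgebraic sets*,
  J. Topology 10 (2017), 765–775, Thm. 1.1 (statement only).
* [CzaplaPawlucki2018] M. Czapla, W. Pawłucki, *Strict `C¹`-triangulations in o-minimal
  structures*, Topol. Methods Nonlinear Anal. 52 (2018), 739–747 (the cubic step `φ`).
-/

noncomputable section

open Set Filter Finset
open _root_.Topology

namespace Literature.ModelTheory.ExponentialFields

open Literature.NumberTheory.Transcendental (IsSemialgebraicFunOn IsSemialgebraicMapOn
  isSemialgebraicFunOn_iff)

section FlatReparam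

/-! ### The profile: derivative bounds of the cubic smoothstep -/

/-- `0 ≤ φ' ≤ 3/2` (`φ'(t) = 6c(1-c)`, `c = clamp t ∈ [0,1]`). [cite: Pawlucki2024, §4] -/
theorem deriv_smoothstep_nonneg (t : ℝ) : 0 ≤ deriv smoothstep t := by
  rw [deriv_smoothstep]
  have h := stepClamp_mem t
  exact mul_nonneg (mul_nonneg (by norm_num) h.1) (by linarith [h.2])

/-- `φ' ≤ 3/2`. [cite: Pawlucki2024, §4] -/
theorem deriv_smoothstep_le (t : ℝ) : deriv smoothstep t ≤ 3 / 2 := by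
  rw [deriv_smoothstep]
  have h := stepClamp_mem t
  nlinarith [sq_nonneg (stepClamp t - 1 / 2), h.1, h.2]

/-- `|φ'| ≤ 3/2`. [cite: Pawlucki2024, §4] -/
theorem abs_deriv_smoothstep_le (t : ℝ) : |deriv smoothstep t| ≤ 3 / 2 := by
  rw [abs_of_nonneg (deriv_smoothstep_nonneg t)]
  exact deriv_smoothstep_le t

/-- `φ'` vanishes outside `(0, 1)`: left of `0`. [cite: Pawlucki2024, §4] -/
theorem deriv_smoothstep_of_nonpos {t : ℝ} (ht : t ≤ 0) : deriv smoothstep t = 0 := by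
  rw [deriv_smoothstep, stepClamp_of_nonpos ht]; ring

/-- `φ'` vanishes outside `(0, 1)`: right of `1`. [cite: Pawlucki2024, §4] -/
theorem deriv_smoothstep_of_one_le {t : ℝ} (ht : 1 ≤ t) : deriv smoothstep t = 0 := by
  rw [deriv_smoothstep, stepClamp_of_one_le ht]; ring

/-- `φ'` is continuous. [cite: Pawlucki2024, §4] -/
theorem continuous_deriv_smoothstep : Continuous (deriv smoothstep) :=
  contDiff_one_smoothstep.continuous_deriv le_rfl

/-- `φ` is monotone on `ℝ`. [cite: Pawlucki2024, §4] -/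
theorem monotone_smoothstep : Monotone smoothstep :=
  monotone_of_deriv_nonneg contDiff_one_smoothstep.differentiable_one (deriv_smoothstep_nonneg)

/-! ### Nodes, widths and the flat reparametrization `ω` -/

variable (y : ℕ → ℝ)

/-- The gaps `Δ_j = y_{j+1} - y_j` of a sequence of nodes. [cite: Pawlucki2024, Cor. 4.5] -/
def frGap (j : ℕ) : ℝ := y (j + 1) - y j

/-- The widths `W_j = √Δ_j` of the source pieces (so that `Δ_j / W_j = W_j → 0` with the gap:
the `p = 1` substitute for Pawłucki's `m·(Δ/2)^{1/m}`). [cite: Pawlucki2024, Cor. 4.4] -/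
def frW (j : ℕ) : ℝ := Real.sqrt (frGap y j)

/-- The source nodes `κ_i = ∑_{j<i} W_j`. [cite: Pawlucki2024, Cor. 4.5] -/
def frNode (i : ℕ) : ℝ := ∑ j ∈ range i, frW y j

/-- **The flat reparametrization** `ω(s) = y₀ + ∑_{j<r} Δ_j φ((s - κ_j)/W_j)` through `r` pieces.
[cite: Pawlucki2024, Cor. 4.5] -/
def frOmega (r : ℕ) (s : ℝ) : ℝ :=
  y 0 + ∑ j ∈ range r, frGap y j * smoothstep ((s - frNode y j) / frW y j)

/-- Its derivative `ω'(s) = ∑_{j<r} W_j φ'((s - κ_j)/W_j)`. [cite: Pawlucki2024, Cor. 4.5] -/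
def frOmegaD (r : ℕ) (s : ℝ) : ℝ :=
  ∑ j ∈ range r, frW y j * deriv smoothstep ((s - frNode y j) / frW y j)

variable {y}

/-- Gaps of a monotone sequence are nonnegative. [cite: Pawlucki2024, Cor. 4.5] -/
theorem frGap_nonneg (hy : Monotone y) (j : ℕ) : 0 ≤ frGap y j :=
  sub_nonneg.2 (hy (Nat.le_succ j))

/-- `W_j ≥ 0`. [cite: Pawlucki2024, Cor. 4.4] -/
theorem frW_nonneg (j : ℕ) : 0 ≤ frW y j := Real.sqrt_nonneg _

/-- `W_j² = Δ_j`. [cite: Pawlucki2024, Cor. 4.4] -/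
theorem frW_sq (hy : Monotone y) (j : ℕ) : frW y j ^ 2 = frGap y j :=
  Real.sq_sqrt (frGap_nonneg hy j)

/-- `W_j * W_j = Δ_j`. [cite: Pawlucki2024, Cor. 4.4] -/
theorem frW_mul_self (hy : Monotone y) (j : ℕ) : frW y j * frW y j = frGap y j := by
  rw [← sq, frW_sq hy]

/-- `W_j = 0 ↔ Δ_j = 0`. [cite: Pawlucki2024, Cor. 4.4] -/
theorem frW_eq_zero_iff (hy : Monotone y) (j : ℕ) : frW y j = 0 ↔ frGap y j = 0 := by
  constructor
  · intro h; rw [← frW_mul_self hy, h, zero_mul]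
  · intro h; simp [frW, h]

/-- `Δ_j / W_j = W_j` (also in the degenerate case, `0/0 = 0`). [cite: Pawlucki2024, Cor. 4.4] -/
theorem frGap_div_frW (hy : Monotone y) (j : ℕ) : frGap y j / frW y j = frW y j := by
  by_cases h : frW y j = 0
  · rw [h, div_zero]
  · rw [div_eq_iff h, frW_mul_self hy]

/-- `κ_0 = 0`. [cite: Pawlucki2024, Cor. 4.5] -/
@[simp] theorem frNode_zero : frNode y 0 = 0 := by simp [frNode]

/-- `κ_{i+1} = κ_i + W_i`. [cite: Pawlucki2024, Cor. 4.5] -/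
theorem frNode_succ (i : ℕ) : frNode y (i + 1) = frNode y i + frW y i := by
  simp [frNode, sum_range_succ]

/-- The source nodes increase. [cite: Pawlucki2024, Cor. 4.5] -/
theorem frNode_mono : Monotone (frNode y) :=
  monotone_nat_of_le_succ fun i => by rw [frNode_succ]; exact le_add_of_nonneg_right (frW_nonneg i)

/-- `0 ≤ κ_i`. [cite: Pawlucki2024, Cor. 4.5] -/
theorem frNode_nonneg (i : ℕ) : 0 ≤ frNode y i := by
  simpa using frNode_mono (y := y) (Nat.zero_le i)

/-- `κ_j + W_j ≤ κ_i` for `j < i`. [cite: Pawlucki2024, Cor. 4.5] -/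
theorem frNode_add_frW_le {j i : ℕ} (h : j < i) : frNode y j + frW y j ≤ frNode y i := by
  rw [← frNode_succ]; exact frNode_mono h

/-- The telescoping sum of the gaps. [cite: Pawlucki2024, Cor. 4.5] -/
theorem sum_frGap (i : ℕ) : ∑ j ∈ range i, frGap y j = y i - y 0 := by
  simp only [frGap]
  exact sum_range_sub y i

/-- Past pieces are fully traversed at a later node: `Δ_j φ((κ_i - κ_j)/W_j) = Δ_j` for `j < i`.
[cite: Pawlucki2024, Cor. 4.5] -/
theorem frGap_mul_smoothstep_of_lt (hy : Monotone y) {j i : ℕ} (h : j < i) {s : ℝ}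
    (hs : frNode y i ≤ s) : frGap y j * smoothstep ((s - frNode y j) / frW y j) = frGap y j := by
  by_cases hW : frW y j = 0
  · rw [(frW_eq_zero_iff hy j).1 hW, zero_mul]
  · have hWpos : 0 < frW y j := lt_of_le_of_ne (frW_nonneg j) (Ne.symm hW)
    rw [smoothstep_of_one_le, mul_one]
    rw [le_div_iff₀ hWpos, one_mul]
    linarith [frNode_add_frW_le (y := y) h]

/-- Future pieces are not yet entered: `φ((s - κ_j)/W_j) = 0` for `s ≤ κ_j`.
[cite: Pawlucki2024, Cor. 4.5] -/
theorem smoothstep_eq_zero_of_le {j : ℕ} {s : ℝ} (hs : s ≤ frNode y j) :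
    smoothstep ((s - frNode y j) / frW y j) = 0 :=
  smoothstep_of_nonpos (div_nonpos_of_nonpos_of_nonneg (sub_nonpos.2 hs) (frW_nonneg j))

/-- **`ω(κ_i) = y_i`** for `i ≤ r`. [cite: Pawlucki2024, Cor. 4.5] -/
theorem frOmega_node (hy : Monotone y) {r i : ℕ} (hi : i ≤ r) : frOmega y r (frNode y i) = y i := by
  unfold frOmega
  rw [← sum_range_add_sum_Ico _ hi]
  have h1 : ∑ j ∈ range i, frGap y j * smoothstep ((frNode y i - frNode y j) / frW y j) =
      ∑ j ∈ range i, frGap y j :=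
    sum_congr rfl fun j hj => frGap_mul_smoothstep_of_lt hy (mem_range.1 hj) le_rfl
  have h2 : ∑ j ∈ Ico i r, frGap y j * smoothstep ((frNode y i - frNode y j) / frW y j) = 0 :=
    sum_eq_zero fun j hj => by
      rw [smoothstep_eq_zero_of_le (frNode_mono (mem_Ico.1 hj).1), mul_zero]
  rw [h1, h2, add_zero, sum_frGap]; ring

/-- `ω(s) = y₀` for `s ≤ 0`. [cite: Pawlucki2024, Cor. 4.5] -/
theorem frOmega_of_nonpos {r : ℕ} {s : ℝ} (hs : s ≤ 0) : frOmega y r s = y 0 := by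
  unfold frOmega
  rw [sum_eq_zero fun j _ => ?_, add_zero]
  rw [smoothstep_eq_zero_of_le (hs.trans (frNode_nonneg j)), mul_zero]

/-- `ω(s) = y_r` for `κ_r ≤ s`. [cite: Pawlucki2024, Cor. 4.5] -/
theorem frOmega_of_node_le (hy : Monotone y) {r : ℕ} {s : ℝ} (hs : frNode y r ≤ s) :
    frOmega y r s = y r := by
  unfold frOmega
  rw [sum_congr rfl fun j hj => frGap_mul_smoothstep_of_lt hy (mem_range.1 hj) hs, sum_frGap]
  ring

/-- `ω` is monotone in `s`. [cite: Pawlucki2024, Cor. 4.5] -/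
theorem frOmega_mono (hy : Monotone y) (r : ℕ) : Monotone (frOmega y r) := by
  intro s s' hss'
  unfold frOmega
  refine add_le_add le_rfl (sum_le_sum fun j _ => mul_le_mul_of_nonneg_left ?_ (frGap_nonneg hy j))
  exact monotone_smoothstep (div_le_div_of_nonneg_right (sub_le_sub_right hss' _) (frW_nonneg j))

/-- `y₀ ≤ ω ≤ y_r`. [cite: Pawlucki2024, Cor. 4.5] -/
theorem frOmega_mem_Icc (hy : Monotone y) (r : ℕ) (s : ℝ) : frOmega y r s ∈ Icc (y 0) (y r) := by
  constructor
  · rw [← frOmega_of_nonpos (y := y) (r := r) (le_refl (0:ℝ))]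
    rcases le_total s 0 with h | h
    · rw [frOmega_of_nonpos h, frOmega_of_nonpos le_rfl]
    · exact frOmega_mono hy r h
  · rw [← frOmega_of_node_le hy (r := r) le_rfl]
    rcases le_total s (frNode y r) with h | h
    · exact frOmega_mono hy r h
    · rw [frOmega_of_node_le hy h, frOmega_of_node_le hy le_rfl]

/-! ### Differentiability of `ω` -/

/-- Derivative of one term `Δ_j φ((s - κ_j)/W_j)`: `W_j φ'((s - κ_j)/W_j)` (degenerate pieces are
constant). [cite: Pawlucki2024, Cor. 4.4] -/
theorem hasDerivAt_frOmega_term (hy : Monotone y) (j : ℕ) (s : ℝ) :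
    HasDerivAt (fun s => frGap y j * smoothstep ((s - frNode y j) / frW y j))
      (frW y j * deriv smoothstep ((s - frNode y j) / frW y j)) s := by
  by_cases hW : frW y j = 0
  · have hΔ : frGap y j = 0 := (frW_eq_zero_iff hy j).1 hW
    simp only [hΔ, hW, zero_mul]
    exact hasDerivAt_const _ _
  · have hlin : HasDerivAt (fun s => (s - frNode y j) / frW y j) (1 / frW y j) s := by
      simpa using ((hasDerivAt_id s).sub_const (frNode y j)).div_const (frW y j)
    have h : HasDerivAt (fun s => frGap y j * smoothstep ((s - frNode y j) / frW y j))
        (frGap y j * (6 * stepClamp ((s - frNode y j) / frW y j) *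
          (1 - stepClamp ((s - frNode y j) / frW y j)) * (1 / frW y j))) s :=
      ((hasDerivAt_smoothstep _).comp s hlin).const_mul (frGap y j)
    refine h.congr_deriv ?_
    rw [deriv_smoothstep, ← frW_mul_self hy j]
    field_simp

/-- **`ω` is differentiable with derivative `ω'`** (everywhere on `ℝ`). [cite: Pawlucki2024, Cor. 4.5] -/
theorem hasDerivAt_frOmega (hy : Monotone y) (r : ℕ) (s : ℝ) :
    HasDerivAt (frOmega y r) (frOmegaD y r s) s := by
  unfold frOmega frOmegaD
  have h := HasDerivAt.sum (u := range r) fun j _ => hasDerivAt_frOmega_term hy j s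
  simpa using h.const_add (y 0)

/-- `ω' ≥ 0`. [cite: Pawlucki2024, Cor. 4.5] -/
theorem frOmegaD_nonneg (r : ℕ) (s : ℝ) : 0 ≤ frOmegaD y r s :=
  sum_nonneg fun j _ => mul_nonneg (frW_nonneg j) (deriv_smoothstep_nonneg _)

/-- A term of `ω'` vanishes unless `s` lies strictly inside its piece. [cite: Pawlucki2024, Cor. 4.5] -/
theorem frOmegaD_term_eq_zero {j : ℕ} {s : ℝ} (hs : s ≤ frNode y j ∨ frNode y j + frW y j ≤ s) :
    frW y j * deriv smoothstep ((s - frNode y j) / frW y j) = 0 := by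
  by_cases hW : frW y j = 0
  · rw [hW, zero_mul]
  have hWpos : 0 < frW y j := lt_of_le_of_ne (frW_nonneg j) (Ne.symm hW)
  rcases hs with hs | hs
  · rw [deriv_smoothstep_of_nonpos, mul_zero]
    exact div_nonpos_of_nonpos_of_nonneg (sub_nonpos.2 hs) hWpos.le
  · rw [deriv_smoothstep_of_one_le, mul_zero]
    rw [le_div_iff₀ hWpos]; linarith

/-- **`ω'(κ_i) = 0`**: the reparametrization is flat at every node. [cite: Pawlucki2024, Cor. 4.5] -/
theorem frOmegaD_node (r i : ℕ) : frOmegaD y r (frNode y i) = 0 := by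
  unfold frOmegaD
  refine sum_eq_zero fun j _ => frOmegaD_term_eq_zero ?_
  rcases Nat.lt_or_ge j i with h | h
  · exact Or.inr (frNode_add_frW_le h)
  · exact Or.inl (frNode_mono h)

/-- `ω' = 0` left of `0`. [cite: Pawlucki2024, Cor. 4.5] -/
theorem frOmegaD_of_nonpos (r : ℕ) {s : ℝ} (hs : s ≤ 0) : frOmegaD y r s = 0 :=
  sum_eq_zero fun j _ => frOmegaD_term_eq_zero (Or.inl (hs.trans (frNode_nonneg j)))

/-- `ω' = 0` right of `κ_r`. [cite: Pawlucki2024, Cor. 4.5] -/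
theorem frOmegaD_of_node_le {r : ℕ} {s : ℝ} (hs : frNode y r ≤ s) : frOmegaD y r s = 0 :=
  sum_eq_zero fun _ hj => frOmegaD_term_eq_zero (Or.inr ((frNode_add_frW_le (mem_range.1 hj)).trans hs))

/-- On the piece `[κ_j, κ_{j+1}]` only the `j`-th term of `ω'` survives. [cite: Pawlucki2024, Cor. 4.5] -/
theorem frOmegaD_eq_term {r j : ℕ} (hj : j < r) {s : ℝ} (hs : s ∈ Icc (frNode y j) (frNode y (j + 1))) :
    frOmegaD y r s = frW y j * deriv smoothstep ((s - frNode y j) / frW y j) := by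
  unfold frOmegaD
  rw [← sum_erase_add _ _ (mem_range.2 hj)]
  rw [sum_eq_zero fun i hi => ?_, zero_add]
  have hij : i ≠ j := (mem_erase.1 hi).1
  refine frOmegaD_term_eq_zero ?_
  rcases lt_or_gt_of_ne hij with h | h
  · exact Or.inr ((frNode_add_frW_le h).trans hs.1)
  · refine Or.inl (hs.2.trans ?_)
    exact frNode_mono (Nat.succ_le_of_lt h)

/-- **`|ω'| ≤ (3/2) W_j` on the `j`-th piece** (so `ω' → 0` with the gap). [cite: Pawlucki2024, Cor. 4.4] -/
theorem frOmegaD_le_of_mem {r j : ℕ} (hj : j < r) {s : ℝ} (hs : s ∈ Icc (frNode y j) (frNode y (j + 1))) :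
    frOmegaD y r s ≤ 3 / 2 * frW y j := by
  rw [frOmegaD_eq_term hj hs, mul_comm]
  exact mul_le_mul_of_nonneg_right (deriv_smoothstep_le _) (frW_nonneg j)

/-- A crude global bound: `ω' ≤ (3/2) ∑_j W_j = (3/2) κ_r`. [cite: Pawlucki2024, Cor. 4.4] -/
theorem frOmegaD_le (r : ℕ) (s : ℝ) : frOmegaD y r s ≤ 3 / 2 * frNode y r := by
  unfold frOmegaD frNode
  rw [mul_sum]
  refine sum_le_sum fun j _ => ?_
  rw [mul_comm (3/2 : ℝ)]
  exact mul_le_mul_of_nonneg_left (deriv_smoothstep_le _) (frW_nonneg j)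

/-! ### Pieces and strict monotonicity -/

/-- Every `s ∈ [0, κ_r)` lies in a (necessarily nondegenerate) piece `[κ_j, κ_{j+1})`, `j < r`.
[cite: Pawlucki2024, Cor. 4.5] -/
theorem exists_piece_of_lt {r : ℕ} {s : ℝ} (hs0 : 0 ≤ s) (hs : s < frNode y r) :
    ∃ j < r, frNode y j ≤ s ∧ s < frNode y (j + 1) := by
  induction r with
  | zero => simp at hs; linarith
  | succ r ih =>
    by_cases h : s < frNode y r
    · obtain ⟨j, hj, h1, h2⟩ := ih h
      exact ⟨j, Nat.lt_succ_of_lt hj, h1, h2⟩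
    · exact ⟨r, Nat.lt_succ_self r, le_of_not_gt h, hs⟩

/-- A piece containing a point strictly before its end is nondegenerate. [cite: Pawlucki2024, Cor. 4.5] -/
theorem frW_pos_of_lt {j : ℕ} {s : ℝ} (h1 : frNode y j ≤ s) (h2 : s < frNode y (j + 1)) :
    0 < frW y j := by
  rw [frNode_succ] at h2
  linarith

/-- Inside a nondegenerate piece `ω` is strictly increasing. [cite: Pawlucki2024, Cor. 4.5] -/
theorem frOmega_lt_frOmega_of_piece (hy : Monotone y) {r j : ℕ} (hj : j < r) {s s' : ℝ}
    (h1 : frNode y j ≤ s) (hss' : s < s') (h2 : s' ≤ frNode y (j + 1)) :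
    frOmega y r s < frOmega y r s' := by
  have hW : 0 < frW y j := frW_pos_of_lt h1 (hss'.trans_le h2)
  have hΔ : 0 < frGap y j := by rw [← frW_mul_self hy]; exact mul_pos hW hW
  unfold frOmega
  refine (add_lt_add_iff_left (y 0)).2 (sum_lt_sum (fun i _ => ?_) ⟨j, mem_range.2 hj, ?_⟩)
  · exact mul_le_mul_of_nonneg_left (monotone_smoothstep
      (div_le_div_of_nonneg_right (sub_le_sub_right hss'.le _) (frW_nonneg i))) (frGap_nonneg hy i)
  · refine mul_lt_mul_of_pos_left (strictMonoOn_smoothstep ⟨?_, ?_⟩ ⟨?_, ?_⟩ ?_) hΔ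
    · exact div_nonneg (sub_nonneg.2 h1) hW.le
    · rw [div_le_one hW, frNode_succ] at *; linarith
    · exact div_nonneg (by linarith) hW.le
    · rw [div_le_one hW]; rw [frNode_succ] at h2; linarith
    · exact div_lt_div_of_pos_right (by linarith) hW

/-- **`ω` is strictly increasing on `[0, κ_r]`.** [cite: Pawlucki2024, Cor. 4.5] -/
theorem strictMonoOn_frOmega (hy : Monotone y) (r : ℕ) :
    StrictMonoOn (frOmega y r) (Icc 0 (frNode y r)) := by
  intro s hs s' hs' hss'
  obtain ⟨j, hj, h1, h2⟩ := exists_piece_of_lt hs.1 (hss'.trans_le hs'.2)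
  rcases le_or_gt s' (frNode y (j + 1)) with h | h
  · exact frOmega_lt_frOmega_of_piece hy hj h1 hss' h
  · exact (frOmega_lt_frOmega_of_piece hy hj h1 h2 le_rfl).trans_le (frOmega_mono hy r h.le)

/-- `ω` is injective on `[0, κ_r]`. [cite: Pawlucki2024, Cor. 4.5] -/
theorem injOn_frOmega (hy : Monotone y) (r : ℕ) : InjOn (frOmega y r) (Icc 0 (frNode y r)) :=
  (strictMonoOn_frOmega hy r).injOn

/-- `ω` maps `[0, κ_r]` onto `[y₀, y_r]`. [cite: Pawlucki2024, Cor. 4.5] -/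
theorem surjOn_frOmega (hy : Monotone y) (r : ℕ) :
    SurjOn (frOmega y r) (Icc 0 (frNode y r)) (Icc (y 0) (y r)) := by
  have hc : ContinuousOn (frOmega y r) (Icc 0 (frNode y r)) := fun s _ =>
    (hasDerivAt_frOmega hy r s).continuousAt.continuousWithinAt
  have h := intermediate_value_Icc (frNode_nonneg r) hc
  rwa [frOmega_of_nonpos le_rfl, frOmega_of_node_le hy le_rfl] at h

/-- Points of the open piece `(κ_j, κ_{j+1})` are mapped into the open target piece
`(y_j, y_{j+1})`. [cite: Pawlucki2024, Cor. 4.5] -/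
theorem frOmega_mem_Ioo (hy : Monotone y) {r j : ℕ} (hj : j < r) {s : ℝ}
    (hs : s ∈ Ioo (frNode y j) (frNode y (j + 1))) : frOmega y r s ∈ Ioo (y j) (y (j + 1)) := by
  constructor
  · rw [← frOmega_node hy hj.le]
    exact frOmega_lt_frOmega_of_piece hy hj le_rfl hs.1 hs.2.le
  · rw [← frOmega_node hy (Nat.succ_le_of_lt hj)]
    exact frOmega_lt_frOmega_of_piece hy hj hs.1.le hs.2 le_rfl

/-- Off the open pieces the derivative `ω'` vanishes. [cite: Pawlucki2024, Cor. 4.5] -/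
theorem frOmegaD_eq_zero_of_forall {r : ℕ} {s : ℝ}
    (hs : ∀ j < r, ¬ (frNode y j < s ∧ s < frNode y (j + 1))) : frOmegaD y r s = 0 := by
  refine sum_eq_zero fun j hj => frOmegaD_term_eq_zero ?_
  rw [← frNode_succ]
  have h := hs j (mem_range.1 hj)
  by_contra hcon
  rw [not_or, not_le, not_le] at hcon
  exact h ⟨hcon.1, hcon.2⟩

/-! ### Joint continuity in parameters -/

section Param

variable {X : Type*} [TopologicalSpace X]

/-- Continuity of a "pinching term" `u · ψ(g / W)`: where `W ≠ 0` by composition, where `W = 0`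
because `u` vanishes there and `ψ` is bounded. [cite: Pawlucki2024, Cor. 4.5] -/
theorem continuous_mul_bdd_comp_div {u W g : X → ℝ} {ψ : ℝ → ℝ} {M : ℝ} (hψ : Continuous ψ)
    (hM : ∀ t, |ψ t| ≤ M) (hu : Continuous u) (hW : Continuous W) (hg : Continuous g)
    (h0 : ∀ x, W x = 0 → u x = 0) : Continuous fun x => u x * ψ (g x / W x) := by
  refine continuous_iff_continuousAt.2 fun x₀ => ?_
  by_cases hx : W x₀ = 0
  · have hu0 : u x₀ = 0 := h0 x₀ hx
    rw [ContinuousAt, hu0, zero_mul]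
    refine squeeze_zero_norm (a := fun x => |u x| * M) (fun x => ?_) ?_
    · rw [Real.norm_eq_abs, abs_mul]
      exact mul_le_mul_of_nonneg_left (hM _) (abs_nonneg _)
    · have h := (continuous_abs.comp hu).continuousAt (x := x₀)
      have h' : Tendsto (fun x => |u x| * M) (𝓝 x₀) (𝓝 (|u x₀| * M)) := h.tendsto.mul_const M
      rwa [hu0, abs_zero, zero_mul] at h'
  · exact hu.continuousAt.mul (hψ.continuousAt.comp (hg.continuousAt.div hW.continuousAt hx))

variable {Y : X → ℕ → ℝ}

/-- Continuity of the gaps in the parameter. [cite: Pawlucki2024, Cor. 4.5] -/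
theorem continuous_frGap (hYc : ∀ j, Continuous fun x => Y x j) (j : ℕ) :
    Continuous fun x => frGap (Y x) j :=
  (hYc (j + 1)).sub (hYc j)

/-- Continuity of the widths in the parameter. [cite: Pawlucki2024, Cor. 4.5] -/
theorem continuous_frW (hYc : ∀ j, Continuous fun x => Y x j) (j : ℕ) :
    Continuous fun x => frW (Y x) j :=
  (continuous_frGap hYc j).sqrt

/-- Continuity of the nodes in the parameter. [cite: Pawlucki2024, Cor. 4.5] -/
theorem continuous_frNode (hYc : ∀ j, Continuous fun x => Y x j) (i : ℕ) :
    Continuous fun x => frNode (Y x) i := by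
  unfold frNode
  exact continuous_finsetSum _ fun j _ => continuous_frW hYc j

/-- **Joint continuity of `ω(x, s)`** in the parameter and the variable (degenerate pieces
included). [cite: Pawlucki2024, Cor. 4.5, (5.1.1)] -/
theorem continuous_frOmega (hYc : ∀ j, Continuous fun x => Y x j) (hYm : ∀ x, Monotone (Y x))
    (r : ℕ) : Continuous fun p : X × ℝ => frOmega (Y p.1) r p.2 := by
  unfold frOmega
  refine ((hYc 0).comp continuous_fst).add (continuous_finsetSum _ fun j _ => ?_)
  refine continuous_mul_bdd_comp_div (M := 1) continuous_smoothstep (fun t => ?_)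
    ((continuous_frGap hYc j).comp continuous_fst) ((continuous_frW hYc j).comp continuous_fst)
    (continuous_snd.sub ((continuous_frNode hYc j).comp continuous_fst)) fun p hp => ?_
  · have h := smoothstep_mem_Icc t
    rw [abs_of_nonneg h.1]; exact h.2
  · exact (frW_eq_zero_iff (hYm p.1) j).1 hp

/-- **Joint continuity of `ω'(x, s)`.** [cite: Pawlucki2024, Cor. 4.5, (5.1.2)] -/
theorem continuous_frOmegaD (hYc : ∀ j, Continuous fun x => Y x j) (r : ℕ) :
    Continuous fun p : X × ℝ => frOmegaD (Y p.1) r p.2 := by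
  unfold frOmegaD
  refine continuous_finsetSum _ fun j _ => ?_
  exact continuous_mul_bdd_comp_div (M := 3 / 2) continuous_deriv_smoothstep abs_deriv_smoothstep_le
    ((continuous_frW hYc j).comp continuous_fst) ((continuous_frW hYc j).comp continuous_fst)
    (continuous_snd.sub ((continuous_frNode hYc j).comp continuous_fst)) fun _ hp => hp

end Param

/-! ### Lipschitz bounds from derivative bounds on open pieces -/

section Lipschitz

variable {F : Type*} [NormedAddCommGroup F] [NormedSpace ℝ F]

/-- Mean value inequality on a closed interval from a derivative bound on the OPEN interval and
continuity on the closed one. [cite: Pawlucki2024, Lemma 4.3] -/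
theorem norm_sub_le_mul_of_hasDerivAt_Ioo {θ θ' : ℝ → F} {a b L : ℝ} (hc : ContinuousOn θ (Icc a b))
    (hd : ∀ t ∈ Ioo a b, HasDerivAt θ (θ' t) t) (hb : ∀ t ∈ Ioo a b, ‖θ' t‖ ≤ L)
    {u v : ℝ} (hu : u ∈ Icc a b) (hv : v ∈ Icc a b) (huv : u ≤ v) : ‖θ v - θ u‖ ≤ L * (v - u) := by
  rcases huv.lt_or_eq with hlt | rfl
  swap; · simp
  -- for `u < u' < v`: the segment estimate on `[u', v]`
  have hseg : ∀ u' ∈ Ioo u v, ‖θ v - θ u'‖ ≤ L * (v - u') := by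
    intro u' hu'
    have hsub : Icc u' v ⊆ Icc a b := Icc_subset_Icc (hu.1.trans hu'.1.le) hv.2
    refine norm_image_sub_le_of_norm_deriv_right_le_segment (hc.mono hsub) (fun t ht => ?_)
      (fun t ht => hb t ⟨hu.1.trans_lt (hu'.1.trans_le ht.1), ht.2.trans_le hv.2⟩) v
      (right_mem_Icc.2 hu'.2.le)
    exact (hd t ⟨hu.1.trans_lt (hu'.1.trans_le ht.1), ht.2.trans_le hv.2⟩).hasDerivWithinAt
  -- let `u' → u⁺`
  haveI : (𝓝[Ioo u v] u).NeBot := left_nhdsWithin_Ioo_neBot hlt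
  have h1 : Tendsto (fun u' => ‖θ v - θ u'‖) (𝓝[Ioo u v] u) (𝓝 ‖θ v - θ u‖) := by
    have hcu : ContinuousWithinAt θ (Ioo u v) u :=
      (hc u hu).mono (Ioo_subset_Icc_self.trans (Icc_subset_Icc hu.1 hv.2))
    exact ((continuous_norm.tendsto _).comp (tendsto_const_nhds.sub hcu.tendsto))
  have h2 : Tendsto (fun u' => L * (v - u')) (𝓝[Ioo u v] u) (𝓝 (L * (v - u))) :=
    ((tendsto_const_nhds.sub tendsto_id).const_mul L).mono_left nhdsWithin_le_nhds
  exact le_of_tendsto_of_tendsto h1 h2 (eventually_nhdsWithin_of_forall hseg)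

/-- Lipschitz bound on `[y₀, y_r]` for a function continuous there with derivative bounded by `L`
on each open piece `(y_j, y_{j+1})` (chaining the pieces through the nodes). [cite: Pawlucki2024, Lemma 4.3] -/
theorem norm_sub_le_mul_of_pieces {y : ℕ → ℝ} (hy : Monotone y) {θ θ' : ℝ → F} {L : ℝ} :
    ∀ r : ℕ, ContinuousOn θ (Icc (y 0) (y r)) →
      (∀ j < r, ∀ t ∈ Ioo (y j) (y (j + 1)), HasDerivAt θ (θ' t) t) →
      (∀ j < r, ∀ t ∈ Ioo (y j) (y (j + 1)), ‖θ' t‖ ≤ L) →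
      ∀ {u v : ℝ}, u ∈ Icc (y 0) (y r) → v ∈ Icc (y 0) (y r) → u ≤ v → ‖θ v - θ u‖ ≤ L * (v - u)
  | 0, _, _, _, u, v, hu, hv, _ => by
    have hu' : u = y 0 := le_antisymm hu.2 hu.1
    have hv' : v = y 0 := le_antisymm hv.2 hv.1
    simp [hu', hv']
  | r + 1, hc, hd, hb, u, v, hu, hv, huv => by
    have hyr : y r ≤ y (r + 1) := hy (Nat.le_succ r)
    have hy0 : y 0 ≤ y r := hy (Nat.zero_le r)
    -- the last piece alone
    have hlast : ∀ {u v : ℝ}, u ∈ Icc (y r) (y (r + 1)) → v ∈ Icc (y r) (y (r + 1)) → u ≤ v →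
        ‖θ v - θ u‖ ≤ L * (v - u) := fun hu hv huv =>
      norm_sub_le_mul_of_hasDerivAt_Ioo (hc.mono (Icc_subset_Icc hy0 le_rfl))
        (hd r (Nat.lt_succ_self r)) (hb r (Nat.lt_succ_self r)) hu hv huv
    -- the first `r` pieces, by induction
    have hfirst : ∀ {u v : ℝ}, u ∈ Icc (y 0) (y r) → v ∈ Icc (y 0) (y r) → u ≤ v →
        ‖θ v - θ u‖ ≤ L * (v - u) := fun hu hv huv =>
      norm_sub_le_mul_of_pieces hy r (hc.mono (Icc_subset_Icc le_rfl hyr))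
        (fun j hj => hd j (Nat.lt_succ_of_lt hj)) (fun j hj => hb j (Nat.lt_succ_of_lt hj)) hu hv huv
    rcases le_total v (y r) with hvr | hvr
    · exact hfirst ⟨hu.1, huv.trans hvr⟩ ⟨hv.1, hvr⟩ huv
    rcases le_total (y r) u with hur | hur
    · exact hlast ⟨hur, hu.2⟩ ⟨hvr, hv.2⟩ huv
    · calc ‖θ v - θ u‖ = ‖(θ v - θ (y r)) + (θ (y r) - θ u)‖ := by rw [sub_add_sub_cancel]
        _ ≤ ‖θ v - θ (y r)‖ + ‖θ (y r) - θ u‖ := norm_add_le _ _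
        _ ≤ L * (v - y r) + L * (y r - u) :=
          add_le_add (hlast ⟨le_rfl, hyr⟩ ⟨hvr, hv.2⟩ hvr) (hfirst ⟨hu.1, hur⟩ ⟨hy0, le_rfl⟩ hur)
        _ = L * (v - u) := by ring

end Lipschitz

/-! ### The composition lemma (Pawłucki's Cor. 4.4 for `p = 1`, with parameters) -/

section Composition

variable {F : Type*} [NormedAddCommGroup F] [NormedSpace ℝ F]

/-- **Flat composition, one fibre** [Pawlucki2024, Lemma 4.3 / Cor. 4.4 for `p = 1`]: if `θ` is
continuous on `[y₀, y_r]` and differentiable on the open pieces with `‖θ'‖ ≤ L`, then `θ ∘ ω`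
is differentiable EVERYWHERE with derivative `ω'(s) • θ'(ω(s))` — in particular with derivative
`0` at all nodes (and outside `[0, κ_r]`). [cite: Pawlucki2024, Cor. 4.4] -/
theorem hasDerivAt_comp_frOmega {y : ℕ → ℝ} (hy : Monotone y) {r : ℕ} {θ θ' : ℝ → F} {L : ℝ}
    (hc : ContinuousOn θ (Icc (y 0) (y r)))
    (hd : ∀ j < r, ∀ t ∈ Ioo (y j) (y (j + 1)), HasDerivAt θ (θ' t) t)
    (hb : ∀ j < r, ∀ t ∈ Ioo (y j) (y (j + 1)), ‖θ' t‖ ≤ L) (s : ℝ) :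
    HasDerivAt (fun s => θ (frOmega y r s)) (frOmegaD y r s • θ' (frOmega y r s)) s := by
  by_cases hs : ∃ j < r, frNode y j < s ∧ s < frNode y (j + 1)
  · -- inside an open piece: the chain rule
    obtain ⟨j, hj, hs⟩ := hs
    have hmem := frOmega_mem_Ioo hy hj hs
    exact (hd j hj _ hmem).scomp s (hasDerivAt_frOmega hy r s)
  · -- at a node (or outside): derivative `0`, since `ω' = 0` there and `θ` is Lipschitz
    have hD : frOmegaD y r s = 0 := frOmegaD_eq_zero_of_forall fun j hj h => hs ⟨j, hj, h⟩
    rw [hD, zero_smul, hasDerivAt_iff_isLittleO]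
    simp only [smul_zero, sub_zero]
    have hω := hasDerivAt_frOmega hy r s
    rw [hD, hasDerivAt_iff_isLittleO] at hω
    simp only [smul_zero, sub_zero] at hω
    refine Asymptotics.IsBigO.trans_isLittleO ?_ hω
    refine Asymptotics.IsBigO.of_bound (max L 0) (Eventually.of_forall fun s' => ?_)
    have hL : ∀ j < r, ∀ t ∈ Ioo (y j) (y (j + 1)), ‖θ' t‖ ≤ max L 0 :=
      fun j hj t ht => (hb j hj t ht).trans (le_max_left _ _)
    rw [Real.norm_eq_abs]
    rcases le_total (frOmega y r s) (frOmega y r s') with h | h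
    · rw [abs_of_nonneg (sub_nonneg.2 h)]
      exact norm_sub_le_mul_of_pieces hy r hc hd hL (frOmega_mem_Icc hy r s)
        (frOmega_mem_Icc hy r s') h
    · rw [abs_of_nonpos (sub_nonpos.2 h), ← norm_neg, neg_sub, neg_sub]
      exact norm_sub_le_mul_of_pieces hy r hc hd hL (frOmega_mem_Icc hy r s')
        (frOmega_mem_Icc hy r s) h

variable {X : Type*} [TopologicalSpace X] {Y : X → ℕ → ℝ}

/-- The union of the open pieces of a continuous laminar family is open in `X × ℝ`.
[cite: Pawlucki2024, Cor. 4.5] -/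
theorem isOpen_setOf_mem_openPiece (hYc : ∀ j, Continuous fun x => Y x j) (r : ℕ) :
    IsOpen {p : X × ℝ | ∃ j < r, Y p.1 j < p.2 ∧ p.2 < Y p.1 (j + 1)} := by
  have : {p : X × ℝ | ∃ j < r, Y p.1 j < p.2 ∧ p.2 < Y p.1 (j + 1)} =
      ⋃ j ∈ Finset.range r, {p : X × ℝ | Y p.1 j < p.2 ∧ p.2 < Y p.1 (j + 1)} := by
    ext p
    constructor
    · rintro ⟨j, hj, h⟩
      exact Set.mem_iUnion₂.2 ⟨j, Finset.mem_range.2 hj, h⟩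
    · intro h
      obtain ⟨j, hj, h⟩ := Set.mem_iUnion₂.1 h
      exact ⟨j, Finset.mem_range.1 hj, h⟩
  rw [this]
  refine isOpen_biUnion fun j _ => ?_
  exact (isOpen_lt ((hYc j).comp continuous_fst) continuous_snd).inter
    (isOpen_lt continuous_snd ((hYc (j + 1)).comp continuous_fst))

/-- **Flat composition with parameters** [Pawlucki2024, Cor. 4.4–4.5 for `p = 1`, (5.1.2),
(5.1.5), (8.1.8)]: for a laminar family `y₀(x) ≤ ⋯ ≤ y_r(x)` depending continuously on `x` and a
map `θ(x, t)` whose `t`-derivative on the open pieces is jointly continuous and bounded by `L`,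
the `s`-derivative `ω'_x(s) • ∂_tθ(x, ω_x(s))` of `θ(x, ω_x(s))` is **jointly continuous on all of
`X × ℝ`** — it vanishes at every node, at every pinch point and outside the source capsule, i.e.
it is the continuous extension by zero of the derivative on the open pieces. [cite: Pawlucki2024, (5.1.2)] -/
theorem continuous_frOmegaD_smul_comp (hYc : ∀ j, Continuous fun x => Y x j)
    (hYm : ∀ x, Monotone (Y x)) {r : ℕ} {θ' : X → ℝ → F} {L : ℝ}
    (hθ'c : ContinuousOn (fun p : X × ℝ => θ' p.1 p.2)
      {p : X × ℝ | ∃ j < r, Y p.1 j < p.2 ∧ p.2 < Y p.1 (j + 1)})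
    (hb : ∀ x, ∀ j < r, ∀ t ∈ Ioo (Y x j) (Y x (j + 1)), ‖θ' x t‖ ≤ L) :
    Continuous fun p : X × ℝ => frOmegaD (Y p.1) r p.2 • θ' p.1 (frOmega (Y p.1) r p.2) := by
  have hωc := continuous_frOmega hYc hYm r
  have hωDc := continuous_frOmegaD hYc r
  refine continuous_iff_continuousAt.2 fun p₀ => ?_
  by_cases hs : ∃ j < r, frNode (Y p₀.1) j < p₀.2 ∧ p₀.2 < frNode (Y p₀.1) (j + 1)
  · -- inside an open piece: composition of continuous maps
    obtain ⟨j, hj, hs⟩ := hs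
    refine hωDc.continuousAt.smul ?_
    have hmap : ContinuousAt (fun p : X × ℝ => (p.1, frOmega (Y p.1) r p.2)) p₀ :=
      (continuousAt_fst.prodMk hωc.continuousAt)
    refine ContinuousAt.comp (g := fun q : X × ℝ => θ' q.1 q.2) ?_ hmap
    refine (hθ'c.continuousAt ((isOpen_setOf_mem_openPiece hYc r).mem_nhds ?_))
    exact ⟨j, hj, frOmega_mem_Ioo (hYm p₀.1) hj hs⟩
  · -- at a node / pinch point / outside: squeeze by `max L 0 * |ω'| → 0`
    have hD : frOmegaD (Y p₀.1) r p₀.2 = 0 :=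
      frOmegaD_eq_zero_of_forall fun j hj h => hs ⟨j, hj, h⟩
    rw [ContinuousAt, hD, zero_smul]
    refine squeeze_zero_norm (a := fun p : X × ℝ => max L 0 * |frOmegaD (Y p.1) r p.2|)
      (fun p => ?_) ?_
    · rw [norm_smul, Real.norm_eq_abs, mul_comm]
      by_cases hp : ∃ j < r, frNode (Y p.1) j < p.2 ∧ p.2 < frNode (Y p.1) (j + 1)
      · obtain ⟨j, hj, hp⟩ := hp
        exact mul_le_mul_of_nonneg_right
          ((hb p.1 j hj _ (frOmega_mem_Ioo (hYm p.1) hj hp)).trans (le_max_left _ _)) (abs_nonneg _)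
      · rw [frOmegaD_eq_zero_of_forall fun j hj h => hp ⟨j, hj, h⟩, abs_zero, mul_zero, mul_zero]
    · have h := ((continuous_abs.comp hωDc).continuousAt (x := p₀)).tendsto.const_mul (max L 0)
      simp only [Function.comp] at h
      rwa [hD, abs_zero, mul_zero] at h

omit [NormedSpace ℝ F] in
/-- Joint continuity of the composite `θ(x, ω_x(s))` itself. [cite: Pawlucki2024, (5.1.1)] -/
theorem continuousOn_comp_frOmega (hYc : ∀ j, Continuous fun x => Y x j) (hYm : ∀ x, Monotone (Y x))
    {r : ℕ} {θ : X → ℝ → F} {S : Set X}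
    (hθc : ContinuousOn (fun p : X × ℝ => θ p.1 p.2) {p : X × ℝ | p.1 ∈ S ∧ p.2 ∈ Icc (Y p.1 0) (Y p.1 r)}) :
    ContinuousOn (fun p : X × ℝ => θ p.1 (frOmega (Y p.1) r p.2)) {p : X × ℝ | p.1 ∈ S} := by
  have hωc := continuous_frOmega hYc hYm r
  have hmap : Continuous (fun p : X × ℝ => (p.1, frOmega (Y p.1) r p.2)) :=
    continuous_fst.prodMk hωc
  refine hθc.comp hmap.continuousOn fun p hp => ?_
  exact ⟨hp, frOmega_mem_Icc (hYm p.1) r p.2⟩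

end Composition

/-! ### Continuity of partial inverses on compact sets -/

/-- The partial inverse `invFunOn f s` of a map continuous and injective on a compact set `s` is
continuous on `f '' s` (Hausdorff target): closed subsets of `s` have compact, hence closed,
images.  Used for every fibrewise inverse of the construction. [folklore] -/
theorem continuousOn_invFunOn_of_isCompact_injOn {α β : Type*} [TopologicalSpace α]
    [TopologicalSpace β] [T2Space β] [Nonempty α] {s : Set α} (hs : IsCompact s) {f : α → β}
    (hf : ContinuousOn f s) (hinj : InjOn f s) : ContinuousOn (Function.invFunOn f s) (f '' s) := by
  rw [continuousOn_iff_isClosed]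
  intro C hC
  refine ⟨f '' (s ∩ C),
    ((hs.inter_right hC).image_of_continuousOn (hf.mono inter_subset_left)).isClosed, ?_⟩
  ext b
  constructor
  · rintro ⟨hbC, a, ha, rfl⟩
    exact ⟨⟨Function.invFunOn f s (f a), ⟨Function.invFunOn_mem ⟨a, ha, rfl⟩, hbC⟩,
      Function.invFunOn_eq ⟨a, ha, rfl⟩⟩, a, ha, rfl⟩
  · rintro ⟨⟨a, ⟨has, haC⟩, rfl⟩, -⟩
    refine ⟨?_, a, has, rfl⟩
    show Function.invFunOn f s (f a) ∈ C
    rw [hinj.leftInvOn_invFunOn has]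
    exact haC

/-- A continuous injection of a compact set is a homeomorphism onto its image: if moreover the
image is `t`, then `invFunOn f s` is a two-sided inverse, continuous on `t`. [folklore] -/
theorem exists_continuousOn_inverse_of_isCompact {α β : Type*} [TopologicalSpace α]
    [TopologicalSpace β] [T2Space β] [Nonempty α] {s : Set α} {t : Set β} (hs : IsCompact s)
    {f : α → β} (hf : ContinuousOn f s) (hinj : InjOn f s) (hst : f '' s = t) :
    ∃ g : β → α, ContinuousOn g t ∧ MapsTo g t s ∧ (∀ a ∈ s, g (f a) = a) ∧ ∀ b ∈ t, f (g b) = b := by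
  refine ⟨Function.invFunOn f s, hst ▸ continuousOn_invFunOn_of_isCompact_injOn hs hf hinj,
    fun b hb => ?_, fun a ha => hinj.leftInvOn_invFunOn ha, fun b hb => ?_⟩
  · rw [← hst] at hb
    exact Function.invFunOn_mem hb
  · rw [← hst] at hb
    exact Function.invFunOn_eq hb

/-! ### Semialgebraicity of `ω` in all variables -/

section Semialgebraic

variable {k : ℕ} {S : Set (Fin k → ℝ)} {Yf : ℕ → (Fin k → ℝ) → ℝ}

/-- The gaps of a semialgebraic laminar family are semialgebraic. [cite: Pawlucki2024, Lemma 5.1] -/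
theorem isSemialgebraicFunOn_frGap (hY : ∀ j, IsSemialgebraicFunOn ℝ S (Yf j)) (j : ℕ) :
    IsSemialgebraicFunOn ℝ S (fun x => frGap (fun i => Yf i x) j) :=
  IsSemialgebraicFunOn.sub_holds (hY (j + 1)) (hY j)

/-- The widths are semialgebraic. [cite: Pawlucki2024, Lemma 5.1] -/
theorem isSemialgebraicFunOn_frW (hY : ∀ j, IsSemialgebraicFunOn ℝ S (Yf j)) (j : ℕ) :
    IsSemialgebraicFunOn ℝ S (fun x => frW (fun i => Yf i x) j) :=
  IsSemialgebraicFunOn.sqrt_holds (isSemialgebraicFunOn_frGap hY j)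

/-- The nodes are semialgebraic. [cite: Pawlucki2024, Lemma 5.1] -/
theorem isSemialgebraicFunOn_frNode (hS : IsSemialgebraic ℝ S)
    (hY : ∀ j, IsSemialgebraicFunOn ℝ S (Yf j)) (i : ℕ) :
    IsSemialgebraicFunOn ℝ S (fun x => frNode (fun i => Yf i x) i) :=
  IsSemialgebraicFunOn.finset_sum hS _ fun j _ => isSemialgebraicFunOn_frW hY j

/-- **`(x, s) ↦ ω_x(s)` is semialgebraic** (on `S × ℝ ⊆ ℝᵏ⁺¹`) when the nodes are semialgebraic
functions of `x ∈ S`. [cite: Pawlucki2024, Lemma 5.1] -/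
theorem isSemialgebraicFunOn_frOmega (hS : IsSemialgebraic ℝ S)
    (hY : ∀ j, IsSemialgebraicFunOn ℝ S (Yf j)) (r : ℕ) :
    IsSemialgebraicFunOn ℝ {p : Fin (k + 1) → ℝ | Fin.init p ∈ S}
      (fun p => frOmega (fun i => Yf i (Fin.init p)) r (p (Fin.last k))) := by
  have hS' : IsSemialgebraic ℝ {p : Fin (k + 1) → ℝ | Fin.init p ∈ S} := hS.setOf_init_mem
  unfold frOmega
  refine IsSemialgebraicFunOn.add_holds (hY 0).comp_init (IsSemialgebraicFunOn.finset_sum hS' _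
    fun j _ => IsSemialgebraicFunOn.mul_holds (isSemialgebraicFunOn_frGap hY j).comp_init ?_)
  refine IsSemialgebraicFunOn.smoothstep_comp hS' (IsSemialgebraicFunOn.div₀ hS' ?_ ?_)
  · exact IsSemialgebraicFunOn.sub_holds (isSemialgebraicFunOn_apply hS' (Fin.last k))
      (isSemialgebraicFunOn_frNode hS hY j).comp_init
  · exact (isSemialgebraicFunOn_frW hY j).comp_init

end Semialgebraic

/-! ### The piece profile `W² φ(σ/W)` is `C¹` in width and offset jointly -/

section PieceProfile

/-- Pawłucki's piece profile as a function of the width and the offset: `Π(W, σ) = W² φ(σ / W)`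
(`= Δ φ((s - κ)/W)` with `Δ = W²`, `σ = s - κ`); `Π(0, σ) = 0`. [cite: Pawlucki2024, Cor. 4.5] -/
def frPiece (p : ℝ × ℝ) : ℝ := p.1 ^ 2 * smoothstep (p.2 / p.1)

/-- `ω = y₀ + ∑_j Π(κ_{j+1} - κ_j, s - κ_j)`: the reparametrization is an explicit `C¹` expression
in the NODES `κ_j` and `s` (the widths are differences of nodes), which is what makes
`(u, s) ↦ ω_{h(u)}(s)` of class `C¹` once the nodes are smoothed. [cite: Pawlucki2024, (5.1.6), (8.1.15)] -/
theorem frOmega_eq_sum_frPiece (hy : Monotone y) (r : ℕ) (s : ℝ) :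
    frOmega y r s = y 0 + ∑ j ∈ range r, frPiece (frNode y (j + 1) - frNode y j, s - frNode y j) := by
  unfold frOmega frPiece
  congr 1
  refine sum_congr rfl fun j _ => ?_
  rw [frNode_succ, add_sub_cancel_left, frW_sq hy]

/-- `|Π(W, σ)| ≤ W²`. [cite: Pawlucki2024, Cor. 4.5] -/
theorem abs_frPiece_le (p : ℝ × ℝ) : |frPiece p| ≤ p.1 ^ 2 := by
  unfold frPiece
  rw [abs_mul, abs_of_nonneg (sq_nonneg _)]
  have h := smoothstep_mem_Icc (p.2 / p.1)
  refine mul_le_of_le_one_right (sq_nonneg _) ?_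
  rw [abs_of_nonneg h.1]; exact h.2

/-- The auxiliary profile `χ(τ) = 2φ(τ) - τ φ'(τ)` (the `W`-partial of `Π` is `W χ(σ/W)`).
[cite: Pawlucki2024, Cor. 4.5] -/
def frChi (τ : ℝ) : ℝ := 2 * smoothstep τ - τ * deriv smoothstep τ

/-- `χ` is continuous. [cite: Pawlucki2024, Cor. 4.5] -/
theorem continuous_frChi : Continuous frChi :=
  (continuous_const.mul continuous_smoothstep).sub (continuous_id.mul continuous_deriv_smoothstep)

/-- `|τ φ'(τ)| ≤ 3/2` (the factor vanishes off `[0,1]`). [cite: Pawlucki2024, Cor. 4.5] -/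
theorem abs_mul_deriv_smoothstep_le (τ : ℝ) : |τ * deriv smoothstep τ| ≤ 3 / 2 := by
  rcases le_or_gt τ 0 with h | h
  · rw [deriv_smoothstep_of_nonpos h, mul_zero, abs_zero]; norm_num
  rcases le_or_gt 1 τ with h' | h'
  · rw [deriv_smoothstep_of_one_le h', mul_zero, abs_zero]; norm_num
  rw [abs_mul, abs_of_pos h]
  calc τ * |deriv smoothstep τ| ≤ 1 * (3 / 2) :=
        mul_le_mul h'.le (abs_deriv_smoothstep_le τ) (abs_nonneg _) zero_le_one
    _ = 3 / 2 := one_mul _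

/-- `|χ| ≤ 7/2`. [cite: Pawlucki2024, Cor. 4.5] -/
theorem abs_frChi_le (τ : ℝ) : |frChi τ| ≤ 7 / 2 := by
  unfold frChi
  have h1 := smoothstep_mem_Icc τ
  have h2 := abs_mul_deriv_smoothstep_le τ
  rw [abs_le] at h2 ⊢
  constructor <;> nlinarith [h1.1, h1.2, h2.1, h2.2]

/-- The candidate derivative field of `Π`: `DΠ(W, σ) = W χ(σ/W) · dW + W φ'(σ/W) · dσ` (zero on
`W = 0`). [cite: Pawlucki2024, Cor. 4.5] -/
def frPieceD (p : ℝ × ℝ) : ℝ × ℝ →L[ℝ] ℝ :=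
  (p.1 * frChi (p.2 / p.1)) • ContinuousLinearMap.fst ℝ ℝ ℝ +
    (p.1 * deriv smoothstep (p.2 / p.1)) • ContinuousLinearMap.snd ℝ ℝ ℝ

/-- The derivative field is continuous on `ℝ²` (pinching terms). [cite: Pawlucki2024, Cor. 4.5] -/
theorem continuous_frPieceD : Continuous frPieceD := by
  unfold frPieceD
  refine ((continuous_mul_bdd_comp_div (M := 7 / 2) continuous_frChi abs_frChi_le continuous_fst
    continuous_fst continuous_snd fun _ h => h).smul continuous_const).add
    ((continuous_mul_bdd_comp_div (M := 3 / 2) continuous_deriv_smoothstep abs_deriv_smoothstep_le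
      continuous_fst continuous_fst continuous_snd fun _ h => h).smul continuous_const)

/-- The `W`-partial of `Π` off `W = 0`. [cite: Pawlucki2024, Cor. 4.5] -/
theorem hasDerivAt_frPiece_fst {W : ℝ} (hW : W ≠ 0) (σ : ℝ) :
    HasDerivAt (fun W => frPiece (W, σ)) (W * frChi (σ / W)) W := by
  unfold frPiece frChi
  have hinv : HasDerivAt (fun W : ℝ => σ / W) (-(σ / W ^ 2)) W := by
    have h := ((hasDerivAt_inv hW).const_mul σ).congr_deriv (g' := -(σ / W ^ 2)) (by ring)
    simpa only [div_eq_mul_inv] using h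
  have hφ := (hasDerivAt_smoothstep (σ / W)).comp W hinv
  rw [← deriv_smoothstep] at hφ
  have hsq : HasDerivAt (fun W : ℝ => W ^ 2) (2 * W) W := by
    simpa using hasDerivAt_pow 2 W
  have h := hsq.mul hφ
  refine h.congr_deriv ?_
  simp only [Function.comp_apply]
  field_simp
  ring

/-- The `σ`-partial of `Π` off `W = 0`. [cite: Pawlucki2024, Cor. 4.5] -/
theorem hasDerivAt_frPiece_snd {W : ℝ} (hW : W ≠ 0) (σ : ℝ) :
    HasDerivAt (fun σ => frPiece (W, σ)) (W * deriv smoothstep (σ / W)) σ := by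
  unfold frPiece
  have hlin : HasDerivAt (fun σ : ℝ => σ / W) (1 / W) σ := by
    simpa using (hasDerivAt_id σ).div_const W
  have hφ := (hasDerivAt_smoothstep (σ / W)).comp σ hlin
  rw [← deriv_smoothstep] at hφ
  have h := hφ.const_mul (W ^ 2)
  refine h.congr_deriv ?_
  rw [one_div, ← mul_assoc, mul_comm (W ^ 2), mul_assoc, sq, mul_assoc, mul_inv_cancel₀ hW,
    mul_one, mul_comm]

/-- A continuous linear functional on `ℝ²` is determined by its values on `(1,0)` and `(0,1)`.
[folklore] -/
theorem clm_prod_ext {L M : ℝ × ℝ →L[ℝ] ℝ} (h1 : L (1, 0) = M (1, 0)) (h2 : L (0, 1) = M (0, 1)) :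
    L = M := by
  ext
  · simpa using h1
  · simpa using h2

/-- **The piece profile `Π(W, σ) = W² φ(σ/W)` is of class `C¹` on `ℝ²`**, with derivative `0` on
the line `W = 0`. [cite: Pawlucki2024, Cor. 4.5] -/
theorem hasFDerivAt_frPiece (p : ℝ × ℝ) : HasFDerivAt frPiece (frPieceD p) p := by
  by_cases hW : p.1 = 0
  · -- on the line `W = 0`: `|Π(q)| ≤ q.1² ≤ ‖q - p‖²`
    have hDq : ∀ q, frPieceD p q = 0 := fun q => by simp [frPieceD, hW]
    have hp0 : frPiece p = 0 := by simp [frPiece, hW]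
    rw [hasFDerivAt_iff_isLittleO_nhds_zero]
    refine Asymptotics.IsLittleO.of_isBigOWith fun c hc => Asymptotics.IsBigOWith.of_bound ?_
    have hball : Metric.ball (0 : ℝ × ℝ) c ∈ 𝓝 (0 : ℝ × ℝ) := Metric.ball_mem_nhds 0 hc
    filter_upwards [hball] with q hq
    rw [Metric.mem_ball, dist_zero_right] at hq
    have hq1 : |q.1| ≤ ‖q‖ := norm_fst_le q
    rw [hDq, hp0, sub_zero, sub_zero]
    calc ‖frPiece (p + q)‖ = |frPiece (p + q)| := Real.norm_eq_abs _
      _ ≤ (p + q).1 ^ 2 := abs_frPiece_le _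
      _ = |q.1| * |q.1| := by rw [Prod.fst_add, hW, zero_add, ← sq_abs, sq]
      _ ≤ ‖q‖ * ‖q‖ := mul_le_mul hq1 hq1 (abs_nonneg _) (norm_nonneg _)
      _ ≤ c * ‖q‖ := mul_le_mul_of_nonneg_right hq.le (norm_nonneg _)
  · -- off the line: smooth, and the derivative is identified through the partials
    have hdiff : DifferentiableAt ℝ frPiece p := by
      have hfe : frPiece = fun q : ℝ × ℝ => q.1 ^ 2 * smoothstep (q.2 * (q.1)⁻¹) := by
        funext q; simp [frPiece, div_eq_mul_inv]
      rw [hfe]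
      have hf1 : DifferentiableAt ℝ (fun q : ℝ × ℝ => q.1) p := differentiableAt_fst
      have hf2 : DifferentiableAt ℝ (fun q : ℝ × ℝ => q.2) p := differentiableAt_snd
      refine (hf1.pow 2).mul ?_
      exact (contDiff_one_smoothstep.differentiable_one _).comp p (hf2.mul (hf1.inv hW))
    have hL := hdiff.hasFDerivAt
    have h1 : fderiv ℝ frPiece p (1, 0) = p.1 * frChi (p.2 / p.1) := by
      have hline : HasDerivAt (fun W : ℝ => ((W, p.2) : ℝ × ℝ)) ((1 : ℝ), (0 : ℝ)) p.1 :=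
        (hasDerivAt_id p.1).prodMk (hasDerivAt_const p.1 p.2)
      have hc := hL.comp_hasDerivAt p.1 hline
      exact hc.unique (hasDerivAt_frPiece_fst hW p.2)
    have h2 : fderiv ℝ frPiece p (0, 1) = p.1 * deriv smoothstep (p.2 / p.1) := by
      have hline : HasDerivAt (fun σ : ℝ => ((p.1, σ) : ℝ × ℝ)) ((0 : ℝ), (1 : ℝ)) p.2 :=
        (hasDerivAt_const p.2 p.1).prodMk (hasDerivAt_id p.2)
      have hc := hL.comp_hasDerivAt p.2 hline
      exact hc.unique (hasDerivAt_frPiece_snd hW p.2)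
    have hE : fderiv ℝ frPiece p = frPieceD p := by
      refine clm_prod_ext ?_ ?_
      · rw [h1]; simp [frPieceD]
      · rw [h2]; simp [frPieceD]
    rwa [hE] at hL

/-- `Π` is `C¹`. [cite: Pawlucki2024, Cor. 4.5] -/
theorem contDiff_frPiece : ContDiff ℝ 1 frPiece :=
  contDiff_one_iff_hasFDerivAt.2 ⟨frPieceD, continuous_frPieceD, hasFDerivAt_frPiece⟩

/-- **Joint `C¹` smoothness of `ω` in smoothed nodes**: if `u ↦ κ_j(u)` (`j ≤ r`) and `u ↦ y₀(u)`
are `C¹` on an open set (e.g. after composing the node functions with Pawłucki's triangulation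
`h`), then `(u, s) ↦ y₀(u) + ∑_j Π(κ_{j+1}(u) - κ_j(u), s - κ_j(u))` is `C¹` there.
[cite: Pawlucki2024, (8.1.15), (8.1.23)] -/
theorem contDiffOn_sum_frPiece {E : Type*} [NormedAddCommGroup E] [NormedSpace ℝ E] {U : Set (E × ℝ)}
    {κ : ℕ → E × ℝ → ℝ} {c : E × ℝ → ℝ} (r : ℕ) (hκ : ∀ j ≤ r, ContDiffOn ℝ 1 (κ j) U)
    (hc : ContDiffOn ℝ 1 c U) :
    ContDiffOn ℝ 1 (fun q => c q + ∑ j ∈ range r, frPiece (κ (j + 1) q - κ j q, q.2 - κ j q)) U := by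
  refine hc.add (ContDiffOn.sum fun j hj => ?_)
  have hj := mem_range.1 hj
  refine contDiff_frPiece.comp_contDiffOn (((hκ (j + 1) hj).sub (hκ j hj.le)).prodMk ?_)
  exact contDiffOn_snd.sub (hκ j hj.le)

end PieceProfile

/-! ### Per-piece versions (derivative data on one piece only) -/

section OnePiece

variable {F : Type*} [NormedAddCommGroup F] [NormedSpace ℝ F]
variable {X : Type*} [TopologicalSpace X] {Y : X → ℕ → ℝ}

/-- **Flat composition on one piece** [Pawlucki2024, (5.1.5)]: if the `t`-derivative `θ'` of
`θ(x, ·)` is given only on the open target piece `(y_i(x), y_{i+1}(x))`, jointly continuous and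
bounded by `L` there, then the zero-extended `s`-derivative `ω'_x(s) • θ'(x, ω_x(s))` is continuous
on the CLOSED source piece `{κ_i(x) ≤ s ≤ κ_{i+1}(x)}` (and vanishes on its boundary, pinch points
included). [cite: Pawlucki2024, (5.1.5)] -/
theorem continuousOn_frOmegaD_smul_comp_piece (hYc : ∀ j, Continuous fun x => Y x j)
    (hYm : ∀ x, Monotone (Y x)) {r i : ℕ} (hi : i < r) {θ' : X → ℝ → F} {L : ℝ}
    (hθ'c : ContinuousOn (fun p : X × ℝ => θ' p.1 p.2) {p : X × ℝ | Y p.1 i < p.2 ∧ p.2 < Y p.1 (i + 1)})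
    (hb : ∀ x, ∀ t ∈ Ioo (Y x i) (Y x (i + 1)), ‖θ' x t‖ ≤ L) :
    ContinuousOn (fun p : X × ℝ => frOmegaD (Y p.1) r p.2 • θ' p.1 (frOmega (Y p.1) r p.2))
      {p : X × ℝ | frNode (Y p.1) i ≤ p.2 ∧ p.2 ≤ frNode (Y p.1) (i + 1)} := by
  have hωc := continuous_frOmega hYc hYm r
  have hωDc := continuous_frOmegaD hYc r
  have hopen : IsOpen {p : X × ℝ | Y p.1 i < p.2 ∧ p.2 < Y p.1 (i + 1)} :=
    (isOpen_lt ((hYc i).comp continuous_fst) continuous_snd).inter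
      (isOpen_lt continuous_snd ((hYc (i + 1)).comp continuous_fst))
  intro p₀ hp₀
  by_cases hs : frNode (Y p₀.1) i < p₀.2 ∧ p₀.2 < frNode (Y p₀.1) (i + 1)
  · -- interior point of the piece
    refine ContinuousAt.continuousWithinAt (hωDc.continuousAt.smul ?_)
    have hmap : ContinuousAt (fun p : X × ℝ => (p.1, frOmega (Y p.1) r p.2)) p₀ :=
      continuousAt_fst.prodMk hωc.continuousAt
    refine ContinuousAt.comp (g := fun q : X × ℝ => θ' q.1 q.2) ?_ hmap
    exact hθ'c.continuousAt (hopen.mem_nhds (frOmega_mem_Ioo (hYm p₀.1) hi hs))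
  · -- boundary point of the piece: a node
    have hnode : p₀.2 = frNode (Y p₀.1) i ∨ p₀.2 = frNode (Y p₀.1) (i + 1) := by
      rcases hp₀.1.lt_or_eq with h | h
      · exact Or.inr (le_antisymm hp₀.2 (le_of_not_gt fun h' => hs ⟨h, h'⟩))
      · exact Or.inl h.symm
    have hD : frOmegaD (Y p₀.1) r p₀.2 = 0 := by
      rcases hnode with h | h <;> rw [h] <;> exact frOmegaD_node r _
    rw [ContinuousWithinAt, hD, zero_smul]
    refine squeeze_zero_norm' (a := fun p : X × ℝ => max L 0 * |frOmegaD (Y p.1) r p.2|) ?_ ?_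
    · refine eventually_nhdsWithin_of_forall fun p hp => ?_
      rw [norm_smul, Real.norm_eq_abs, mul_comm]
      by_cases hp' : frNode (Y p.1) i < p.2 ∧ p.2 < frNode (Y p.1) (i + 1)
      · exact mul_le_mul_of_nonneg_right
          ((hb p.1 _ (frOmega_mem_Ioo (hYm p.1) hi hp')).trans (le_max_left _ _)) (abs_nonneg _)
      · have hnode' : p.2 = frNode (Y p.1) i ∨ p.2 = frNode (Y p.1) (i + 1) := by
          rcases hp.1.lt_or_eq with h | h
          · exact Or.inr (le_antisymm hp.2 (le_of_not_gt fun h' => hp' ⟨h, h'⟩))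
          · exact Or.inl h.symm
        have : frOmegaD (Y p.1) r p.2 = 0 := by
          rcases hnode' with h | h <;> rw [h] <;> exact frOmegaD_node r _
        rw [this, abs_zero, mul_zero, mul_zero]
    · have h := ((continuous_abs.comp hωDc).continuousAt (x := p₀)).tendsto.const_mul (max L 0)
      simp only [Function.comp] at h
      rw [hD, abs_zero, mul_zero] at h
      exact h.mono_left nhdsWithin_le_nhds

/-- The fibrewise derivative on one open piece (chain rule). [cite: Pawlucki2024, (5.1.5)] -/
theorem hasDerivAt_comp_frOmega_piece {y : ℕ → ℝ} (hy : Monotone y) {r i : ℕ} (hi : i < r)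
    {θ θ' : ℝ → F} (hd : ∀ t ∈ Ioo (y i) (y (i + 1)), HasDerivAt θ (θ' t) t) {s : ℝ}
    (hs : s ∈ Ioo (frNode y i) (frNode y (i + 1))) :
    HasDerivAt (fun s => θ (frOmega y r s)) (frOmegaD y r s • θ' (frOmega y r s)) s :=
  (hd _ (frOmega_mem_Ioo hy hi hs)).scomp s (hasDerivAt_frOmega hy r s)

end OnePiece

end FlatReparam

end Literature.ModelTheory.ExponentialFields
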